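import Summits.QuantumAdvantage.AdviceFreeQNC0.CellParityObstruction
import Summits.QuantumAdvantage.AdviceFreeQNC0.WindowLocalization
import HarnessLib

/-!
# Cell qa-qnc0 (rung F-Q1, route RingFrame, crux α `RingToElim`): the BLIND-WINDOW THEOREM —
# a polylog-degree walk strategy that bets BLIND inside one window is beaten

Crux α (`RingHardU`, tree `ringWinU`) is reduced to everywhere-dense strategies
(`ringToElim_of_denseHard`): the low-degree gap theorem (`ringWinU_lowDegGap_le`) beats every
strategy that selects NO position inside some polylog window.  Here the first DENSE family falls:
strategies that may bet at EVERY position, with arbitrary polylog-degree selectors outside a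
window, but whose selectors strictly inside the window do not depend on the window's own bits
("blind" bets; e.g. `y_g ≡ 1` on a run — the strategies of the cell's kit census j255342).

Mechanism (`mixedWinU_blind_eq_cell`).  Split the window content as `w = x ++ z`
(`|x| = L`, `|z| = M`), `i = |x|`, `j = |z|` (mod 3).  On a fibre of the outside bits the game is
the mixed game (`ringWinU_glue3_eq_mixedWinU`); a blind position `0 < g < L` has character
`c + g + |w| + W_g(x)`, so the blind bets in the `x`-half contribute the parity bit
`A_{i+j}(x)`; a blind position in the `z`-half has character `c + g + 2|x| + |z| + W_{g-L}(z)`,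
contributing `B_{2i+j}(z)`; the junction `g = L` contributes a constant `m_{2i+j}`; the two window
ends and the outside triple form an even degree-`≤ D` triple `Φ_{i+j}`.  The triples `A`, `B`, `m`
are even (every position is live for exactly two residues), so the CELL PARITY OBSTRUCTION
(`cellParity_obstruction`) applies:

* `mixedWinU_blind_le` — the mixed game on `L + M` bits with blind interior selectors is won on
  at most `(1 − η₁)·2^{L+M}` contents (`L, M ≥ n₀`, degree `≤ c₁√L, c₁√M`, every charge, every
  even triple);
* `ringWinU_blindWindow_sqrt_le` — **a walk strategy on `p + (L + M) + q` bits with selectors of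
  degree `≤ D ≤ c₁√min(L, M)` whose selectors strictly inside the window `(p, p + L + M)` do not
  read the window wins on at most `(1 − η₁)·2^{p+L+M+q}` inputs, every charge**;
* `ringWinU_blindWindow_le` — polylog form: degree `≤ (log₂ n)^C`, one blind window of
  `≥ 2(log₂ n)^{2C+1} + 1` bits.

So α is reduced further: to strategies that, inside EVERY polylog window, have an interior selector
READING that window (`Theorems/RingFrameRingToElimOfSightedHard.lean`).  The cell's theorem
(prover qn-prover-3, 2026-08-27); not in print.  WHAT THIS IS NOT: strategies whose interior
selectors read their own window (general α) are untouched; `η₁` is tiny; no separation.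

## References

* S. Srinivasan, *A robust version of Hegedűs's lemma, with applications*, TheoretiCS 2 (2023),
  Lemma 3.1 [Srinivasan2023] (through `cellParity_obstruction`).
-/

noncomputable section

namespace Summit.QuantumAdvantage.AdviceFreeQNC0

open Finset
open Literature.Computability.MetaComplexity Literature.Computability.MetaComplexity.Smolensky

variable {L M : ℕ}

/-! ### Small tools -/

/-- Parities add. -/
private theorem decide_odd_add (a b : ℕ) :
    decide ((a + b) % 2 = 1) = xor (decide (a % 2 = 1)) (decide (b % 2 = 1)) := by
  rcases Nat.mod_two_eq_zero_or_one a with ha | ha <;>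
    rcases Nat.mod_two_eq_zero_or_one b with hb | hb <;> simp [Nat.add_mod, ha, hb]

/-- Three pairwise distinct residues mod `3` contain exactly one zero: the parity of the number
of non-zero ones is even. -/
private theorem xor3_decide_mod3 (n0 n1 n2 : ℕ) (h01 : n0 % 3 ≠ n1 % 3) (h02 : n0 % 3 ≠ n2 % 3)
    (h12 : n1 % 3 ≠ n2 % 3) :
    xor (decide (n0 % 3 ≠ 0)) (xor (decide (n1 % 3 ≠ 0)) (decide (n2 % 3 ≠ 0))) = false := by
  cases h0 : decide (n0 % 3 ≠ 0) <;> cases h1 : decide (n1 % 3 ≠ 0) <;>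
    cases h2 : decide (n2 % 3 ≠ 0) <;>
    simp only [decide_eq_true_eq, decide_eq_false_iff_not, not_not] at h0 h1 h2 <;>
    first | rfl | omega

/-- The parity bit of a filter of a singleton. -/
private theorem decide_card_filter_singleton {α : Type*} [DecidableEq α] (a : α) (p : α → Prop)
    [DecidablePred p] :
    decide ((({a} : Finset α).filter p).card % 2 = 1) = decide (p a) := by
  rw [Finset.filter_singleton]
  by_cases h : p a <;> simp [h]

/-- A parity of counts indexed by a residue parameter entering each character additively is an
even triple: `⊕_{r<3} [#{g ∈ S : (κ_g + r) mod 3 ≠ 0} odd] = 0`. -/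
private theorem xor3_parity_counts {ι : Type*} (S : Finset ι) (κ : ι → ℕ) :
    xor (decide ((S.filter fun g => (κ g + 0) % 3 ≠ 0).card % 2 = 1))
      (xor (decide ((S.filter fun g => (κ g + 1) % 3 ≠ 0).card % 2 = 1))
        (decide ((S.filter fun g => (κ g + 2) % 3 ≠ 0).card % 2 = 1))) = false := by
  classical
  have hcount : ∀ r, (S.filter fun g => (κ g + r) % 3 ≠ 0).card =
      ∑ g ∈ S, (if (κ g + r) % 3 ≠ 0 then 1 else 0) := fun r => by
    rw [Finset.card_filter]
  have hsum : (S.filter fun g => (κ g + 0) % 3 ≠ 0).card + (S.filter fun g => (κ g + 1) % 3 ≠ 0).card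
      + (S.filter fun g => (κ g + 2) % 3 ≠ 0).card = 2 * S.card := by
    rw [hcount 0, hcount 1, hcount 2, ← Finset.sum_add_distrib, ← Finset.sum_add_distrib,
      Finset.card_eq_sum_ones, Finset.mul_sum]
    refine Finset.sum_congr rfl fun g _ => ?_
    split_ifs <;> omega
  rw [← decide_odd_add, ← decide_odd_add, ← Nat.add_assoc, hsum]
  simp

/-! ### The blind mixed game is a cell game -/

/-- **The fibre of a blind window is a cell game.**  For the mixed game on `L + M` bits whose
window strategy `y` has CONSTANT selectors `s g` at the interior positions `0 < g < L + M`, the win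
bit at `x ++ z` is `Φ_ρ(x ++ z) ⊕ m_σ ⊕ A_ρ(x) ⊕ B_σ(z)` (`ρ = |x| + |z|`, `σ = 2|x| + |z|` mod `3`)
with: `Φ_r` = the triple `P_r` plus the two end positions masked by their characters `c + r`,
`c + L + M + 2r`; `m_r` = the junction position `L` masked by `c + L + r`; `A_r(x)` = parity of the
blind positions `0 < g < L` with `c + g + r + W_g(x) ≢ 0`; `B_r(z)` = parity of the blind positions
`L < g < L + M` with `c + g + r + W_{g−L}(z) ≢ 0`. -/
theorem mixedWinU_blind_eq_cell (hL : 0 < L) (hM : 0 < M) (c : ℕ)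
    (P : ℕ → (Fin (L + M) → Bool) → Bool) (y : Fin (L + M + 1) → (Fin (L + M) → Bool) → Bool)
    (s : Fin (L + M + 1) → Bool)
    (hblind : ∀ g : Fin (L + M + 1), 0 < g.val → g.val < L + M → ∀ w, y g w = s g)
    (x : Fin L → Bool) (z : Fin M → Bool) :
    mixedWinU c P y (Fin.append x z) =
      xor (xor (P ((wt x + wt z) % 3) (Fin.append x z))
            (xor (y 0 (Fin.append x z) && decide ((c + (wt x + wt z) % 3) % 3 ≠ 0))
              (y (Fin.last (L + M)) (Fin.append x z) &&
                decide ((c + (L + M) + 2 * ((wt x + wt z) % 3)) % 3 ≠ 0))))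
        (xor (s ⟨L, by omega⟩ && decide ((c + L + (2 * wt x + wt z) % 3) % 3 ≠ 0))
          (xor (decide ((univ.filter fun g : Fin (L + M + 1) => 0 < g.val ∧ g.val < L ∧
                  s g = true ∧ (c + g.val + (wt x + wt z) % 3 + wtPrefix x g.val) % 3 ≠ 0).card
                    % 2 = 1))
            (decide ((univ.filter fun g : Fin (L + M + 1) => L < g.val ∧ g.val < L + M ∧
                  s g = true ∧ (c + g.val + (2 * wt x + wt z) % 3 + wtPrefix z (g.val - L)) % 3 ≠ 0).card
                    % 2 = 1)))) := by
  classical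
  set w := Fin.append x z with hw
  have hwt : wt w = wt x + wt z := wt_append x z
  -- the selected live positions, split into the five position classes
  set S := univ.filter fun g : Fin (L + M + 1) =>
    y g w = true ∧ (c + g.val + walkExp w g.val) % 3 ≠ 0 with hS
  have hsplit : S.card = (S.filter fun g => g.val = 0).card + (S.filter fun g => 0 < g.val ∧ g.val < L).card
      + (S.filter fun g => g.val = L).card + (S.filter fun g => L < g.val ∧ g.val < L + M).card
      + (S.filter fun g => g.val = L + M).card := by
    have h1 : ∀ g ∈ S, (1 : ℕ) = (if g.val = 0 then 1 else 0) + (if 0 < g.val ∧ g.val < L then 1 else 0)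
        + (if g.val = L then 1 else 0) + (if L < g.val ∧ g.val < L + M then 1 else 0)
        + (if g.val = L + M then 1 else 0) := by
      intro g _
      have := g.isLt
      split_ifs <;> omega
    rw [Finset.card_eq_sum_ones, Finset.sum_congr rfl h1, Finset.sum_add_distrib,
      Finset.sum_add_distrib, Finset.sum_add_distrib, Finset.sum_add_distrib]
    simp only [Finset.card_filter]
  -- class `g = 0`
  have h0 : decide ((S.filter fun g => g.val = 0).card % 2 = 1) =
      (y 0 w && decide ((c + (wt x + wt z) % 3) % 3 ≠ 0)) := by
    have hset : (S.filter fun g => g.val = 0) = ({(0 : Fin (L + M + 1))} : Finset _).filter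
        fun g => y g w = true ∧ (c + g.val + walkExp w g.val) % 3 ≠ 0 := by
      ext g
      simp only [hS, Finset.mem_filter, Finset.mem_univ, true_and, Finset.mem_singleton]
      constructor
      · rintro ⟨h1, h2⟩; exact ⟨Fin.ext h2, h1⟩
      · rintro ⟨h1, h2⟩; exact ⟨h2, by rw [h1]; rfl⟩
    rw [hset, decide_card_filter_singleton]
    have hchar : (c + (0 : Fin (L + M + 1)).val + walkExp w (0 : Fin (L + M + 1)).val) % 3 =
        (c + (wt x + wt z) % 3) % 3 := by
      have hz : wtPrefix w 0 = 0 := by unfold wtPrefix; simp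
      simp only [Fin.val_zero, walkExp, hz, hwt]; omega
    rw [hchar]
    cases y 0 w <;> simp
  -- class `0 < g < L`
  have hA : (S.filter fun g => 0 < g.val ∧ g.val < L) =
      univ.filter fun g : Fin (L + M + 1) => 0 < g.val ∧ g.val < L ∧
        s g = true ∧ (c + g.val + (wt x + wt z) % 3 + wtPrefix x g.val) % 3 ≠ 0 := by
    rw [hS, Finset.filter_filter]
    refine Finset.filter_congr fun g _ => ?_
    constructor
    · rintro ⟨⟨h1, h2⟩, h3, h4⟩
      refine ⟨h3, h4, by rw [← hblind g h3 (by omega) w]; exact h1, ?_⟩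
      unfold walkExp at h2
      rw [hwt, hw, wtPrefix_append_of_le x z (by omega : g.val ≤ L)] at h2
      omega
    · rintro ⟨h3, h4, h1, h2⟩
      refine ⟨⟨by rw [hblind g h3 (by omega) w]; exact h1, ?_⟩, h3, h4⟩
      unfold walkExp
      rw [hwt, hw, wtPrefix_append_of_le x z (by omega : g.val ≤ L)]
      omega
  -- class `g = L`
  have hMid : decide ((S.filter fun g => g.val = L).card % 2 = 1) =
      (s ⟨L, by omega⟩ && decide ((c + L + (2 * wt x + wt z) % 3) % 3 ≠ 0)) := by
    have hset : (S.filter fun g => g.val = L) = (({(⟨L, by omega⟩ : Fin (L + M + 1))} : Finset _).filter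
        fun g => y g w = true ∧ (c + g.val + walkExp w g.val) % 3 ≠ 0) := by
      ext g
      simp only [hS, Finset.mem_filter, Finset.mem_univ, true_and, Finset.mem_singleton]
      constructor
      · rintro ⟨h1, h2⟩; exact ⟨Fin.ext h2, h1⟩
      · rintro ⟨h1, h2⟩; exact ⟨h2, by rw [h1]⟩
    rw [hset, decide_card_filter_singleton]
    have hchar : (c + (⟨L, by omega⟩ : Fin (L + M + 1)).val +
        walkExp w (⟨L, by omega⟩ : Fin (L + M + 1)).val) % 3 = (c + L + (2 * wt x + wt z) % 3) % 3 := by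
      simp only [walkExp, hwt]
      rw [hw, wtPrefix_append_of_le x z le_rfl, wtPrefix_of_length_le x le_rfl]
      omega
    rw [hchar, hblind ⟨L, by omega⟩ hL (show L < L + M by omega) w]
    cases s ⟨L, by omega⟩ <;> simp
  -- class `L < g < L + M`
  have hB : (S.filter fun g => L < g.val ∧ g.val < L + M) =
      univ.filter fun g : Fin (L + M + 1) => L < g.val ∧ g.val < L + M ∧
        s g = true ∧ (c + g.val + (2 * wt x + wt z) % 3 + wtPrefix z (g.val - L)) % 3 ≠ 0 := by
    rw [hS, Finset.filter_filter]
    refine Finset.filter_congr fun g _ => ?_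
    constructor
    · rintro ⟨⟨h1, h2⟩, h3, h4⟩
      refine ⟨h3, h4, by rw [← hblind g (by omega) h4 w]; exact h1, ?_⟩
      unfold walkExp at h2
      rw [hwt, hw, wtPrefix_append_of_ge x z (by omega : L ≤ g.val)] at h2
      omega
    · rintro ⟨h3, h4, h1, h2⟩
      refine ⟨⟨by rw [hblind g (by omega) h4 w]; exact h1, ?_⟩, h3, h4⟩
      unfold walkExp
      rw [hwt, hw, wtPrefix_append_of_ge x z (by omega : L ≤ g.val)]
      omega
  -- class `g = L + M`
  have hE : decide ((S.filter fun g => g.val = L + M).card % 2 = 1) =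
      (y (Fin.last (L + M)) w && decide ((c + (L + M) + 2 * ((wt x + wt z) % 3)) % 3 ≠ 0)) := by
    have hset : (S.filter fun g => g.val = L + M) = (({Fin.last (L + M)} : Finset _).filter
        fun g => y g w = true ∧ (c + g.val + walkExp w g.val) % 3 ≠ 0) := by
      ext g
      simp only [hS, Finset.mem_filter, Finset.mem_univ, true_and, Finset.mem_singleton]
      constructor
      · rintro ⟨h1, h2⟩; exact ⟨Fin.ext (by simp [h2]), h1⟩
      · rintro ⟨h1, h2⟩; exact ⟨h2, by rw [h1]; simp⟩
    rw [hset, decide_card_filter_singleton]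
    have hchar : (c + (Fin.last (L + M)).val + walkExp w (Fin.last (L + M)).val) % 3 =
        (c + (L + M) + 2 * ((wt x + wt z) % 3)) % 3 := by
      simp only [Fin.val_last, walkExp, hwt]
      rw [hw, wtPrefix_of_length_le (Fin.append x z) le_rfl, hwt]
      omega
    rw [hchar]
    cases y (Fin.last (L + M)) w <;> simp
  -- assemble
  unfold mixedWinU ringWinU
  rw [hwt, hsplit, decide_odd_add, decide_odd_add, decide_odd_add, decide_odd_add, h0, hA, hMid, hB, hE]
  generalize P ((wt x + wt z) % 3) w = bP
  generalize (y 0 w && decide ((c + (wt x + wt z) % 3) % 3 ≠ 0)) = b0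
  generalize (y (Fin.last (L + M)) w && decide ((c + (L + M) + 2 * ((wt x + wt z) % 3)) % 3 ≠ 0)) = bE
  generalize (s ⟨L, by omega⟩ && decide ((c + L + (2 * wt x + wt z) % 3) % 3 ≠ 0)) = bM
  generalize decide ((univ.filter fun g : Fin (L + M + 1) => 0 < g.val ∧ g.val < L ∧
    s g = true ∧ (c + g.val + (wt x + wt z) % 3 + wtPrefix x g.val) % 3 ≠ 0).card % 2 = 1) = bA
  generalize decide ((univ.filter fun g : Fin (L + M + 1) => L < g.val ∧ g.val < L + M ∧
    s g = true ∧ (c + g.val + (2 * wt x + wt z) % 3 + wtPrefix z (g.val - L)) % 3 ≠ 0).card % 2 = 1) = bB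
  cases bP <;> cases b0 <;> cases bE <;> cases bM <;> cases bA <;> cases bB <;> rfl

/-! ### The blind mixed game is hard -/
set_option maxHeartbeats 400000 in
/-- **The mixed game with blind interior is hard.**  There are `η₁ > 0`, `c₁ > 0`, `n₀` such that
for `L, M ≥ n₀`, `D ≤ c₁√L`, `D ≤ c₁√M`, every charge `c`, every even triple `P` of degree `≤ D`
and every window strategy `y` of degree `≤ D` on `L + M` bits whose selectors at the interior
positions `0 < g < L + M` are constant, the mixed game is won on at most `(1 − η₁)·2^{L+M}`
window contents. [cite: Srinivasan2023, Lemma 3.1] -/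
theorem mixedWinU_blind_le :
    ∃ η₁ : ℝ, 0 < η₁ ∧ ∃ c₁ : ℝ, 0 < c₁ ∧ ∃ n₀ : ℕ, ∀ L M : ℕ, n₀ ≤ L → n₀ ≤ M →
      ∀ D : ℕ, (D : ℝ) ≤ c₁ * Real.sqrt L → (D : ℝ) ≤ c₁ * Real.sqrt M →
      ∀ (c : ℕ) (P : ℕ → (Fin (L + M) → Bool) → Bool)
        (y : Fin (L + M + 1) → (Fin (L + M) → Bool) → Bool),
        (∀ r, HasDeg (P r) D) → (∀ w, xor (P 0 w) (xor (P 1 w) (P 2 w)) = false) →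
        (∀ g, HasDeg (y g) D) →
        (∀ g : Fin (L + M + 1), 0 < g.val → g.val < L + M → ∀ w w', y g w = y g w') →
        ((univ.filter fun w : Fin (L + M) → Bool => mixedWinU c P y w = true).card : ℝ) ≤
          (1 - η₁) * (2 : ℝ) ^ (L + M) := by
  obtain ⟨η₁, hη₁, c₁, hc₁, n₀, H⟩ := cellParity_obstruction
  refine ⟨η₁, hη₁, c₁, hc₁, max n₀ 1, ?_⟩
  intro L M hL hM D hDL hDM c P y hP hPe hy hblind
  have hn₀L : n₀ ≤ L := le_trans (le_max_left _ _) hL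
  have hn₀M : n₀ ≤ M := le_trans (le_max_left _ _) hM
  have hL1 : 0 < L := lt_of_lt_of_le Nat.one_pos (le_trans (le_max_right _ _) hL)
  have hM1 : 0 < M := lt_of_lt_of_le Nat.one_pos (le_trans (le_max_right _ _) hM)
  set s : Fin (L + M + 1) → Bool := fun g => y g (fun _ => false) with hs
  have hblind' : ∀ g : Fin (L + M + 1), 0 < g.val → g.val < L + M → ∀ w, y g w = s g :=
    fun g h1 h2 w => hblind g h1 h2 w _
  refine H L M hn₀L hn₀M D hDL hDM
    (fun r w => xor (P r w) (xor (y 0 w && decide ((c + r) % 3 ≠ 0))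
      (y (Fin.last (L + M)) w && decide ((c + (L + M) + 2 * r) % 3 ≠ 0))))
    (fun r x => decide ((univ.filter fun g : Fin (L + M + 1) => 0 < g.val ∧ g.val < L ∧
      s g = true ∧ (c + g.val + r + wtPrefix x g.val) % 3 ≠ 0).card % 2 = 1))
    (fun r z => decide ((univ.filter fun g : Fin (L + M + 1) => L < g.val ∧ g.val < L + M ∧
      s g = true ∧ (c + g.val + r + wtPrefix z (g.val - L)) % 3 ≠ 0).card % 2 = 1))
    (fun r => s ⟨L, by omega⟩ && decide ((c + L + r) % 3 ≠ 0))
    (mixedWinU c P y) ?_ ?_ ?_ ?_ ?_ ?_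
  · -- degrees of `Φ`
    intro r
    exact hasDeg_xor (hP r) (hasDeg_xor (hasDeg_and_const' (hy 0) _) (hasDeg_and_const' (hy _) _))
  · -- `Φ` is even
    intro w
    have hPw := hPe w
    have h1 := xor3_decide_mod3 (c + 0) (c + 1) (c + 2) (by omega) (by omega) (by omega)
    have h2 := xor3_decide_mod3 (c + (L + M) + 2 * 0) (c + (L + M) + 2 * 1) (c + (L + M) + 2 * 2)
      (by omega) (by omega) (by omega)
    revert hPw h1 h2
    cases P 0 w <;> cases P 1 w <;> cases P 2 w <;> cases y 0 w <;> cases y (Fin.last (L + M)) w <;>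
      cases decide ((c + 0) % 3 ≠ 0) <;> cases decide ((c + 1) % 3 ≠ 0) <;>
      cases decide ((c + 2) % 3 ≠ 0) <;> cases decide ((c + (L + M) + 2 * 0) % 3 ≠ 0) <;>
      cases decide ((c + (L + M) + 2 * 1) % 3 ≠ 0) <;>
      cases decide ((c + (L + M) + 2 * 2) % 3 ≠ 0) <;> decide
  · -- `A` is even
    intro x
    have h := xor3_parity_counts ((univ : Finset (Fin (L + M + 1))).filter fun g =>
      0 < g.val ∧ g.val < L ∧ s g = true) (fun g => c + g.val + wtPrefix x g.val)
    have heq : ∀ r, (((univ : Finset (Fin (L + M + 1))).filter fun g =>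
        0 < g.val ∧ g.val < L ∧ s g = true).filter fun g =>
          (c + g.val + wtPrefix x g.val + r) % 3 ≠ 0) =
        univ.filter fun g : Fin (L + M + 1) => 0 < g.val ∧ g.val < L ∧
          s g = true ∧ (c + g.val + r + wtPrefix x g.val) % 3 ≠ 0 := by
      intro r
      rw [Finset.filter_filter]
      refine Finset.filter_congr fun g _ => ?_
      rw [show c + g.val + wtPrefix x g.val + r = c + g.val + r + wtPrefix x g.val by ring]
      tauto
    rw [heq 0, heq 1, heq 2] at h
    exact h
  · -- `B` is even
    intro z
    have h := xor3_parity_counts ((univ : Finset (Fin (L + M + 1))).filter fun g =>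
      L < g.val ∧ g.val < L + M ∧ s g = true) (fun g => c + g.val + wtPrefix z (g.val - L))
    have heq : ∀ r, (((univ : Finset (Fin (L + M + 1))).filter fun g =>
        L < g.val ∧ g.val < L + M ∧ s g = true).filter fun g =>
          (c + g.val + wtPrefix z (g.val - L) + r) % 3 ≠ 0) =
        univ.filter fun g : Fin (L + M + 1) => L < g.val ∧ g.val < L + M ∧
          s g = true ∧ (c + g.val + r + wtPrefix z (g.val - L)) % 3 ≠ 0 := by
      intro r
      rw [Finset.filter_filter]
      refine Finset.filter_congr fun g _ => ?_
      rw [show c + g.val + wtPrefix z (g.val - L) + r = c + g.val + r + wtPrefix z (g.val - L) by ring]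
      tauto
    rw [heq 0, heq 1, heq 2] at h
    exact h
  · -- `m` is even
    have h := xor3_decide_mod3 (c + L + 0) (c + L + 1) (c + L + 2) (by omega) (by omega) (by omega)
    revert h
    cases s ⟨L, by omega⟩ <;> cases decide ((c + L + 0) % 3 ≠ 0) <;>
      cases decide ((c + L + 1) % 3 ≠ 0) <;> cases decide ((c + L + 2) % 3 ≠ 0) <;> decide
  · -- the cell formula
    intro x z
    rw [mixedWinU_blind_eq_cell hL1 hM1 c P y s hblind' x z]

/-! ### The blind-window theorem for walk strategies -/

variable {p q : ℕ}

/-- **THE BLIND-WINDOW THEOREM (square-root form).**  There are `θ < 1`, `c₁ > 0`, `n₀` such that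
for all `p, L, M, q` with `L, M ≥ n₀`, every `D ≤ c₁√L`, `D ≤ c₁√M`, every charge and every walk
strategy on `p + (L + M) + q` bits with all selectors of degree `≤ D` whose selectors at the
positions strictly inside the window `(p, p + L + M)` do not depend on the window bits — they may
bet there at will, blind — the ring game in walk coordinates is won on at most
`θ·2^{p+(L+M)+q}` inputs.  (Fibrewise `ringWinU_glue3_eq_mixedWinU` + `mixedWinU_blind_le`, then
Fubini.) [cite: Srinivasan2023, Lemma 3.1] -/
theorem ringWinU_blindWindow_sqrt_le :
    ∃ θ : ℝ, θ < 1 ∧ ∃ c₁ : ℝ, 0 < c₁ ∧ ∃ n₀ : ℕ, ∀ p L M q : ℕ, n₀ ≤ L → n₀ ≤ M →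
      ∀ D : ℕ, (D : ℝ) ≤ c₁ * Real.sqrt L → (D : ℝ) ≤ c₁ * Real.sqrt M →
      ∀ (c : ℕ) (y : Fin (p + (L + M) + q + 1) → (Fin (p + (L + M) + q) → Bool) → Bool),
        (∀ g, HasDeg (y g) D) →
        (∀ g : Fin (p + (L + M) + q + 1), p < g.val → g.val < p + (L + M) →
          ∀ (a : Fin p → Bool) (v v' : Fin (L + M) → Bool) (b : Fin q → Bool),
            y g (glue3 a v b) = y g (glue3 a v' b)) →
        ((univ.filter fun u : Fin (p + (L + M) + q) → Bool => ringWinU c y u = true).card : ℝ) ≤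
          θ * (2 : ℝ) ^ (p + (L + M) + q) := by
  obtain ⟨η₁, hη₁, c₁, hc₁, n₀, H⟩ := mixedWinU_blind_le
  refine ⟨1 - η₁, by linarith, c₁, hc₁, n₀, ?_⟩
  intro p L M q hL hM D hDL hDM c y hdeg hblind
  rw [card_filter_eq_sum_glue3]
  push_cast
  have hfib : ∀ (a : Fin p → Bool) (b : Fin q → Bool),
      ((univ.filter fun v : Fin (L + M) → Bool => ringWinU c y (glue3 a v b) = true).card : ℝ) ≤
        (1 - η₁) * (2 : ℝ) ^ (L + M) := by
    intro a b
    have heq : (univ.filter fun v : Fin (L + M) → Bool => ringWinU c y (glue3 a v b) = true) =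
        univ.filter fun v : Fin (L + M) → Bool =>
          mixedWinU (inCharge c a b) (outParity y c a b) (inStrategy y a b) v = true :=
      Finset.filter_congr fun v _ => by rw [ringWinU_glue3_eq_mixedWinU]
    rw [heq]
    refine H L M hL hM D hDL hDM (inCharge c a b) (outParity y c a b) (inStrategy y a b)
      (hasDeg_outParity c y hdeg a b) (fun v => outParity_even c y a b v)
      (hasDeg_inStrategy y hdeg a b) ?_
    intro g' h1 h2 v v'
    exact hblind ⟨p + g'.val, by omega⟩ (show p < p + g'.val by omega)
      (show p + g'.val < p + (L + M) by omega) a v v' b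
  calc ∑ a : Fin p → Bool, ∑ b : Fin q → Bool,
        ((univ.filter fun v : Fin (L + M) → Bool => ringWinU c y (glue3 a v b) = true).card : ℝ)
      ≤ ∑ _a : Fin p → Bool, ∑ _b : Fin q → Bool, (1 - η₁) * (2 : ℝ) ^ (L + M) :=
        Finset.sum_le_sum fun a _ => Finset.sum_le_sum fun b _ => hfib a b
    _ = (1 - η₁) * (2 : ℝ) ^ (p + (L + M) + q) := by
        simp only [Finset.sum_const, Finset.card_univ, Fintype.card_fun, Fintype.card_bool,
          Fintype.card_fin, nsmul_eq_mul]
        push_cast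
        ring

end Summit.QuantumAdvantage.AdviceFreeQNC0
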